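import Summits.BirchSwinnertonDyer.BirchSwinnertonDyer.Theorems.SignedLowerHalvesSprungLowerDivisibilityAtThreeSharpKernelLayerOne
import Summits.BirchSwinnertonDyer.Rank1Residual.Iwasawa.RankGrowthCyclotomicFactor
import Literature.NumberTheory.EllipticCurves.Sprung2012.SharpFlatSelmerDualExistsProofs
import Mathlib.Algebra.Module.CharacterModule
import HarnessLib

/-!
# Crux K1 `SprungLowerDivisibilityAtThree` (stmt-BirchSwinnertonDyer-19875), line `chromatic-common-zeros`,
# stub S4b at the FIRST cyclotomic prime `(ξ_p)`, `ξ_p = Φ_p(1+T)`: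
# rank growth in the first layer ⇒ `t ≤ ℓ_{(ξ_p)} X♯(E/K_∞)` ⇒ the Eisenstein inequality at `(ξ_p)`
# for BOTH colours (`--supports` 19875 as helper; closes nothing by itself)

The ♯/♭ twin of the Γ-EQUIVARIANT refinement of Greenberg's rank bound (LNM 1716, §5 p. 132, the `34A1`
argument "`E(F) ⊗ (ℚ_3/ℤ_3)` is a `Λ`-submodule of `Sel_E(ℚ_∞)_3`, it follows that `θ_1^t` divides `f_E(T)`",
`θ_1 = Φ_3(1+T)`), which the tree proves for the CLASSICAL Selmer group in
`Rank1Residual/Iwasawa/RankGrowthCyclotomicFactor.lean` (`xi_pow_dvd_of_mem_charIdeal_of_rank_le`). For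
Sprung's chromatic dual `X^• = D.X` (`Sprung2012.SharpFlatSelmerDualData`, Def. 7.9/7.11) the same character
argument runs once the Kummer classes of `E(K_1)` are known to land in `Sel^•(E/K_∞)` — hypothesis
"`Ker Col^•` kills `E(K_1·K_v)`", DISCHARGED for `• = ♯` over `ℚ` by the sibling file
`…SharpKernelLayerOne.lean` (`colemanKer_sharp_apply_eq_zero_of_mem_localLayerPointsOfEmb_one`).

* §1 the `Λ`-action on test classes: `((1+T)^i y)(s) = y(conj_γ^i s)`, `(ξ_p y)(s) = ∑_{i<p} y(conj_γ^i s)`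
  (`toDual_T_smul`; `ξ_p = ∑_{i<p}(1+T)^i`, tree `xi_eq_sum_pow`), and
  `conj_γ^i θ(P ⊗ e_N) = θ(γ^i·P ⊗ e_N)` for the layer-`1` Kummer map (tree `conjH1_kummerLayerToInfty`),
  so `(ξ_p y)(θ(P ⊗ e_N)) = 0` for `P` in the trace-zero lattice `A_ρ = ker(∑_{i<p} γ^i) ⊆ E(K_1)`
  (`rhoLattice`, `sum_layerGal_iterate_eq_zero_of_mem`).
* §2 **`natCast_le_lengthAt_of_rank_le_of_colemanKer`**: for `E/K` over a number field, ANY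
  `ℤ_p`-extension `κ` with topological generator `γ`, a place `v`, data `(ap, g, c, •)` such that `Ker Col^•`
  kills `E(K_1·K_v)`, every dual datum `D` with `X^•` finitely generated, and a height-one `𝔭 = (ξ_p)`:
  `rank E(K) + (p−1)·t ≤ rank E(K_1) ⇒ t ≤ ℓ_𝔭 X^•`. PROOF = the tree proof for the classical Selmer group
  with `θ ↦ θ^•` (lands in `Sel^•` by the sibling `layerToInfty_mem_sharpFlatSelmerInfty_of_mem_selmerLayer`;
  kernel killed by `p^a`, `LayerKummer.exists_pow_smul_ker_kummerLayerToInfty`): `(p−1)t`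
  independent `P_i ∈ A_ρ` with dual functionals (`exists_points_functionals_of_le`), characters
  `p^a c₀(λ_k(·)·)` descended, extended (`ℚ/ℤ` injective) and lifted to `x_k ∈ X^•`; a relation
  `∑ c_k x_k = ξ_p y` evaluated at `θ^•(P_i ⊗ [p^{-N}])` gives `p^N ∣ (c_i mod p^N) p^a N₀` for all `N`, so
  the `x_k` are `ℤ_p`-independent modulo `ξ_p X^•`; rank conversion over `𝒪 = Λ/(ξ_p)` (free of rank
  `p − 1`, `free_finite_finrank_quotient_xi`, `exists_linearIndependent_of_rank_le`) and exactness of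
  localisation (`natCast_le_lengthAt_of_linearIndependent`) give `t ≤ ℓ_𝔭 X^•`. Also `ξ_p^t ∣ f` for
  `f ∈ char X^•` when `X^•` is torsion.
* §3 over `ℚ`, `• = ♯`, the hypothesis discharged (`p ≠ 2`, `p ∣ a_p`, Honda system):
  `rat_natCast_le_lengthAt_sharp_of_rank_le`.
* The sequel `…CyclotomicLowerAtXiDoor.lean` converts this into the S4b currency of the registered stub
  `ChromaticCommonZeros.stub_cyclotomicLowerRest` at its FIRST prime (a height-one `𝔭 ∋ ω_1`, `T ∉ 𝔭`, IS
  `(ξ_p)`): `ℓ_𝔭 Λ/(G^•) ≤ ℓ_𝔭 X^•` for `• = ♯` and, via the lead's colour transfer, for `• = ♭`; at `p = 3`,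
  `ξ_3 = T² + 3T + 3`, `ℚ_1 = ℚ(ζ_9)⁺`, certificate = `2t` new independent points over the cubic field.

HONEST FRAMING: helper theorems `--supports` the crux; the rank-growth input is a per-pair CERTIFICATE
(hypothesis), not a theorem; no named fact; K1, Sprung's Main Conjecture 7.21 and BSD on leaf X8 are NOT
proved by this file; S4b stays OPEN class-wide (and at the primes `Φ_{p^j}(1+T)`, `j ≥ 2`, and at `(T)` in
analytic rank `≥ 2`).

References: R. Greenberg, LNM 1716 (1999), Thm. 1.9 (p. 63), Lemma 3.1 (p. 86), §5 p. 132
[GreenbergLNM1716]; F. Sprung, J. Number Theory 132 (2012), Def. 7.2, 7.9, 7.11, Thm. 7.14, Prop. 7.19,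
Main Conj. 7.21 [Sprung2012]; L. C. Washington, *Introduction to Cyclotomic Fields*, §13.2 [Washington1997].
-/

set_option autoImplicit false
-- justification: the mandated namespace `Summit.BirchSwinnertonDyer.BirchSwinnertonDyer.Theorems`
-- (single-conjunct summit, Sub = Summit) repeats a segment by design (D-0017).
set_option linter.dupNamespace false

noncomputable section

open CategoryTheory Literature.NumberTheory.EllipticCurves Literature.NumberTheory.GaloisRepresentations
  Literature.NumberTheory.EllipticCurves.IwasawaAlgebra
  Literature.NumberTheory.EllipticCurves.Sprung2017 Literature.NumberTheory.EllipticCurves.Sprung2012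
  Literature.NumberTheory.EllipticCurves.Sprung2024 Literature.NumberTheory.EllipticCurves.Kobayashi2003
  WeierstrassCurve WeierstrassCurve.LayerKummer ZpExtension NumberField IsDedekindDomain
  Summit.BirchSwinnertonDyer.Rank1Residual.Iwasawa Summit.BirchSwinnertonDyer.Rank1Residual.X1.CyclotomicZeros

open scoped Classical TensorProduct NumberField

universe u

namespace Summit.BirchSwinnertonDyer.BirchSwinnertonDyer.Theorems.ChromaticCommonZeros

/-! ## §1 The `Λ`-action on test classes of `Sel^•(E/K_∞)` -/

section Dual

variable {K : Type u} [Field K] [NumberField K] {W : WeierstrassCurve K} {p : ℕ} [Fact p.Prime]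
  {κ : ZpExtension K p} {γ : Field.absoluteGaloisGroup K}
  {E : Type u} [Field E] [Algebra K E] {ι : AlgebraicClosure K →ₐ[K] AlgebraicClosure E} {ap : ℤ}
  {g : Field.absoluteGaloisGroup E} {c : ℕ → localPoints W E} {col : Chroma}
  (D : SharpFlatSelmerDualData W κ γ ι ap g c col)

/-- **`((1+T)^i · y)(s) = y(conj_γ^i s)`** on Sprung's `X^• = Hom(Sel^•(E/K_∞), ℚ/ℤ)`: `1 + T` acts as
`conj_γ` (`toDual_T_smul`: `(T·y)(s) = y(conj_γ s) − y(s)`; `conj_γ` restricted to `Sel^•` is the tree's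
`conjSharpFlatSelmerInfty`). Greenberg, LNM 1716, §1 p. 53 (`γ ↦ 1 + T`).
[cite: GreenbergLNM1716, §1 p. 53] [cite: Sprung2012, Def. 7.11 (p. 1503)] -/
theorem sharpFlat_toDual_one_add_X_pow_smul (y : D.X) (i : ℕ)
    (s : sharpFlatSelmerInfty W κ ι ap g c col) :
    D.toDual (((1 + PowerSeries.X : IwasawaAlgebra p) ^ i) • y) s =
      D.toDual y (((conjSharpFlatSelmerInfty W κ ι ap g c col γ) ^ i) s) := by
  induction i generalizing y with
  | zero => rw [pow_zero, one_smul, pow_zero, AddMonoid.End.one_apply]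
  | succ i ih =>
    rw [pow_succ, mul_smul, ih, add_smul, one_smul, map_add, AddMonoidHom.add_apply,
      D.toDual_T_smul, pow_succ', AddMonoid.End.coe_mul, Function.comp_apply]
    have e : (⟨W.conjH1 p κ.kerSubgroup γ
        ((((conjSharpFlatSelmerInfty W κ ι ap g c col γ) ^ i) s : sharpFlatSelmerInfty W κ ι ap g c col) :
          W.subgroupH1 p κ.kerSubgroup), D.conj_mem _
        (((conjSharpFlatSelmerInfty W κ ι ap g c col γ) ^ i) s).2⟩ :
          sharpFlatSelmerInfty W κ ι ap g c col) =
        conjSharpFlatSelmerInfty W κ ι ap g c col γ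
          (((conjSharpFlatSelmerInfty W κ ι ap g c col γ) ^ i) s) := rfl
    rw [e]
    abel

/-- **`(ξ_p · y)(s) = ∑_{i<p} y(conj_γ^i s)`** (`ξ_p = ∑_{i<p} (1+T)^i`, tree `xi_eq_sum_pow`).
[cite: GreenbergLNM1716, §1 p. 53 and §5 p. 132] -/
theorem sharpFlat_toDual_xi_smul (y : D.X) (s : sharpFlatSelmerInfty W κ ι ap g c col) :
    D.toDual (xi p • y) s =
      ∑ i ∈ Finset.range p, D.toDual y (((conjSharpFlatSelmerInfty W κ ι ap g c col γ) ^ i) s) := by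
  rw [xi_eq_sum_pow, Finset.sum_smul, map_sum, AddMonoidHom.finsetSum_apply]
  exact Finset.sum_congr rfl fun i _ ↦ sharpFlat_toDual_one_add_X_pow_smul D y i s

end Dual

/-! ## §2 Rank growth in `K_1` ⇒ `t ≤ ℓ_{(ξ_p)} X^•(E/K_∞)`, given that `Ker Col^•` kills `E(K_1·K_v)` -/

section Main

variable {K : Type u} [Field K] [NumberField K] (W : WeierstrassCurve K) [W.IsElliptic] {p : ℕ}
  [Fact p.Prime] {κ : ZpExtension K p} {γ : Field.absoluteGaloisGroup K} {v : HeightOneSpectrum (𝓞 K)}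
  {ap : ℤ} {g : Field.absoluteGaloisGroup (v.adicCompletion K)}
  {c : ℕ → localPoints W (v.adicCompletion K)} {col : Chroma}

/-- **Rank growth in the first layer ⇒ `t ≤ ℓ_{(ξ_p)} X^•(E/K_∞)`, with the divisibility of `E(K̄)` as
hypothesis `hdiv` and "`Ker Col^•` kills `E(K_1·K_v)`" as hypothesis `h𝒦`.** For `E/K` elliptic over a
number field, ANY `ℤ_p`-extension `κ` with topological generator `γ`, a finite place `v`, chromatic data
`(ap, g, c, •)`, a Pontryagin-dual datum `D` of `Sel^•(E/K_∞)` with `X^• = D.X` finitely generated over `Λ`,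
a prime `𝔭 = (ξ_p)` of `Λ` and `rank E(K) + (p − 1)·t ≤ rank E(K_1)`: `t ≤ length_{Λ_𝔭} X^•_𝔭`. PROOF
(module docstring §2): Greenberg's character argument for the ♯/♭ Kummer map `θ^• : E(K_1) ⊗ ℚ_p/ℤ_p →
Sel^•(E/K_∞)` of the sibling file on test classes from the trace-zero lattice `A_ρ`, then rank conversion
over `𝒪 = Λ/(ξ_p)` and exactness of localisation. No torsion, reduction or cyclotomicity hypothesis.
[cite: GreenbergLNM1716, §5 p. 132 and Thm. 1.9 (p. 63), Lemma 3.1 (p. 86)] [cite: Sprung2012, Def. 7.11 (p. 1503)]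
[cite: Washington1997, §13.2] -/
theorem natCast_le_lengthAt_of_rank_le_of_colemanKer (hdiv : W.zsmul_geomPoints_surjective)
    (hγ : κ.IsTopGenerator γ)
    (h𝒦 : ∀ z ∈ colemanKer κ (closureEmb (K := K) (v.adicCompletion K)) W ap g c col,
      ∀ (x : localPoints W (v.adicCompletion K))
        (hx : x ∈ localLayerPointsOfEmb κ (closureEmb (K := K) (v.adicCompletion K)) W 1),
        z ⟨x, localLayerPointsOfEmb_le_localTowerPointsOfEmb κ _ W 1 hx⟩ = 0)
    (D : SharpFlatSelmerDualData W κ γ (closureEmb (K := K) (v.adicCompletion K)) ap g c col)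
    [Module.Finite (IwasawaAlgebra p) D.X]
    (𝔭 : PrimeSpectrum (IwasawaAlgebra p)) (h𝔭 : 𝔭.asIdeal = Ideal.span {xi p}) {t : ℕ}
    (ht : W.mordellWeilRank + (p - 1) * t ≤ (W.baseChange (κ.layer 1)).mordellWeilRank) :
    (t : ℕ∞) ≤ Module.lengthAt (IwasawaAlgebra p) D.X 𝔭 := by
  have hp := (Fact.out : p.Prime)
  -- decidable equality on the layer `K_1` by classical logic (the instance against which the tree's
  -- `LayerKummer` / `LayerOneNorm` objects are elaborated)
  letI hdec : DecidableEq (κ.layer 1) := fun a b ↦ Classical.propDecidable (a = b)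
  haveI : FiniteDimensional K (κ.layer 1) := κ.finiteDimensional_layer_holds 1
  haveI : NumberField (κ.layer 1) := NumberField.of_module_finite K (κ.layer 1)
  haveI : Module.Finite ℤ (W.baseChange (κ.layer 1)).toAffine.Point :=
    (W.baseChange (κ.layer 1)).module_finite_point_holds
  -- notation
  set S := sharpFlatSelmerInfty W κ (closureEmb (K := K) (v.adicCompletion K)) ap g c col with hSdef
  set ψ := conjSharpFlatSelmerInfty W κ (closureEmb (K := K) (v.adicCompletion K)) ap g c col γ with hψ
  -- the lattice `A_ρ` and its rank
  have hrk : (p - 1) * t ≤ Module.finrank ℤ (rhoLattice W κ γ) := by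
    have := mordellWeilRank_layer_one_le W κ hγ
    omega
  -- points of `A_ρ` and functionals
  obtain ⟨P, lam, N₀, hN₀, hPA, hlam⟩ := exists_points_functionals_of_le (rhoLattice W κ γ)
  obtain ⟨c₀, hc₀⟩ := exists_character_prufGen p
  let c₀' : PruferQuot p →+ AddCircle (1 : ℚ) := c₀
  have hc₀' : ∀ t, c₀' t = c₀ t := fun _ ↦ rfl
  -- the ♯/♭ Kummer map of the layer `θ^• : E(K_1) ⊗ ℚ_p/ℤ_p → Sel^•(E/K_∞)` (the tree's
  -- `θ_1 = LayerKummer.kummerLayerToInfty` lands in `Sel^•` by the sibling landing theorem) …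
  have hmem : ∀ u : (W.baseChange (κ.layer 1)).toAffine.Point ⊗[ℤ] PruferQuot p,
      (kummerLayerToInfty W κ hdiv 1 u : W.subgroupH1 p κ.kerSubgroup) ∈ S := fun u ↦
    layerToInfty_mem_sharpFlatSelmerInfty_of_mem_selmerLayer W κ v 1 h𝒦
      (kummerMap_mem_selmerLayer W κ hdiv 1 u)
  let θ : (W.baseChange (κ.layer 1)).toAffine.Point ⊗[ℤ] PruferQuot p →+ S :=
    ((AddSubgroup.subtype (W.selmerInfty κ)).comp (kummerLayerToInfty W κ hdiv 1)).codRestrict S hmem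
  have hθcoe : ∀ u, (θ u : W.subgroupH1 p κ.kerSubgroup) =
      (kummerLayerToInfty W κ hdiv 1 u : W.subgroupH1 p κ.kerSubgroup) := fun u ↦ rfl
  -- … and has kernel killed by one `p^a` (Greenberg's Lemma 3.1 at layer `1`)
  obtain ⟨a, ha⟩ : ∃ a : ℕ, ∀ u ∈ θ.ker, p ^ a • u = 0 := by
    obtain ⟨a, ha⟩ := exists_pow_smul_ker_kummerLayerToInfty W hdiv hγ 1 (p := p)
    refine ⟨a, fun u hu ↦ ha u ?_⟩
    rw [AddMonoidHom.mem_ker] at hu ⊢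
    apply Subtype.ext
    rw [← hθcoe, hu, ZeroMemClass.coe_zero, ZeroMemClass.coe_zero]
  -- `conj_γ^i θ(P ⊗ e) = θ(γ^i P ⊗ e)`
  have hconj : ∀ (i N : ℕ) (Q : (W.baseChange (κ.layer 1)).toAffine.Point),
      (ψ ^ i) (θ (Q ⊗ₜ[ℤ] prufGen p N)) = θ ((layerGal W κ 1 γ)^[i] Q ⊗ₜ[ℤ] prufGen p N) := by
    intro i N Q
    induction i with
    | zero => rw [pow_zero, AddMonoid.End.one_apply, Function.iterate_zero, id]
    | succ i ih =>
      apply Subtype.ext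
      rw [pow_succ', AddMonoid.End.coe_mul, Function.comp_apply, ih, hψ, coe_conjSharpFlatSelmerInfty_apply, hθcoe,
        conjH1_kummerLayerToInfty, Function.iterate_succ_apply', hθcoe]
  -- `(ξ_p y)(θ(P ⊗ e)) = 0` on `A_ρ`
  have hxi0 : ∀ (y : D.X) (N : ℕ) {Q : (W.baseChange (κ.layer 1)).toAffine.Point},
      Q ∈ rhoLattice W κ γ → D.toDual (xi p • y) (θ (Q ⊗ₜ[ℤ] prufGen p N)) = 0 := by
    intro y N Q hQ
    rw [sharpFlat_toDual_xi_smul]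
    simp_rw [← hψ, hconj]
    rw [← map_sum, ← map_sum, ← TensorProduct.sum_tmul, sum_layerGal_iterate_eq_zero_of_mem W κ γ hQ,
      TensorProduct.zero_tmul, map_zero, map_zero]
  -- the characters `χ_k` of `E(K_1) ⊗ ℚ_p/ℤ_p`, multiplied by `p^a`
  let χ : Fin (Module.finrank ℤ (rhoLattice W κ γ)) →
      ((W.baseChange (κ.layer 1)).toAffine.Point ⊗[ℤ] PruferQuot p →+ AddCircle (1 : ℚ)) :=
    fun k ↦ (c₀'.toIntLinearMap ∘ₗ (TensorProduct.lid ℤ (PruferQuot p)).toLinearMap ∘ₗ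
      ((lam k).rTensor (PruferQuot p))).toAddMonoidHom
  have hχ : ∀ k Q (u : PruferQuot p), χ k (Q ⊗ₜ u) = c₀' (lam k Q • u) := fun k Q u ↦ by
    simp [χ]
  let χ' : Fin (Module.finrank ℤ (rhoLattice W κ γ)) →
      ((W.baseChange (κ.layer 1)).toAffine.Point ⊗[ℤ] PruferQuot p →+ AddCircle (1 : ℚ)) :=
    fun k ↦ (nsmulAddMonoidHom (p ^ a)).comp (χ k)
  have hχ' : ∀ k u, χ' k u = p ^ a • χ k u := fun k u ↦ rfl
  have hker : ∀ k, θ.rangeRestrict.ker ≤ (χ' k).ker := by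
    intro k u hu
    rw [AddMonoidHom.mem_ker] at hu ⊢
    have hu' : u ∈ θ.ker := by
      rw [AddMonoidHom.mem_ker]
      exact congrArg (fun z : θ.range ↦ (z : S)) hu
    rw [hχ', ← map_nsmul, ha u hu', map_zero]
  -- descend to `range θ`
  have hsurj : Function.Surjective θ.rangeRestrict := AddMonoidHom.rangeRestrict_surjective θ
  let φ : Fin (Module.finrank ℤ (rhoLattice W κ γ)) → (θ.range →+ AddCircle (1 : ℚ)) := fun k ↦
    θ.rangeRestrict.liftOfSurjective hsurj ⟨χ' k, hker k⟩
  have hφ : ∀ k u, φ k (θ.rangeRestrict u) = χ' k u := fun k u ↦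
    AddMonoidHom.liftOfRightInverse_comp_apply _ _ _ _ u
  -- extend to characters of `Sel^•_∞` (injectivity of `ℚ/ℤ`)
  have hext : ∀ k, ∃ xt : S →+ AddCircle (1 : ℚ), ∀ s : θ.range, xt s = φ k s := by
    intro k
    obtain ⟨xt, hxt⟩ := CharacterModule.dual_surjective_of_injective
      (θ.range.subtype.toIntLinearMap) (fun a b h ↦ Subtype.ext h) (φ k)
    refine ⟨xt, fun s ↦ ?_⟩
    have := DFunLike.congr_fun hxt s
    rw [CharacterModule.dual_apply] at this
    exact this
  choose xt hxt using hext
  -- lift to `X^•` along `toDual`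
  have hX : ∀ k, ∃ x : D.X, D.toDual x = xt k := fun k ↦ D.bijective.2 (xt k)
  choose x hx using hX
  -- values of the characters on the test elements `θ(P_i ⊗ [p^{-N}])`
  have hval : ∀ k i N, xt k (θ (P i ⊗ₜ[ℤ] prufGen p N)) =
      (p ^ a * if k = i then N₀ else 0) • c₀' (prufGen p N) := by
    intro k i N
    have e1 : θ (P i ⊗ₜ[ℤ] prufGen p N) =
        ((θ.rangeRestrict (P i ⊗ₜ[ℤ] prufGen p N) : θ.range) : S) := rfl
    rw [e1, hxt k, hφ k, hχ', hχ, hlam k i]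
    split_ifs with hki
    · rw [map_zsmul, natCast_zsmul, smul_smul]
    · simp
  -- a relation `∑ c_k x_k = ξ_p y` forces `c = 0`: evaluate at the test elements
  have hx0 : ∀ (cc : Fin (Module.finrank ℤ (rhoLattice W κ γ)) → ℤ_[p]) (y : D.X),
      ∑ k, (PowerSeries.C (cc k) : IwasawaAlgebra p) • x k = xi p • y → ∀ k, cc k = 0 := by
    intro cc y hcy i
    have hdvd : ∀ N, p ^ N ∣ (PadicInt.toZModPow N (cc i)).val * (p ^ a * N₀) := by
      intro N
      have hsN : p ^ N • θ (P i ⊗ₜ[ℤ] prufGen p N) = 0 := by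
        rw [← map_nsmul, ← natCast_zsmul, ← TensorProduct.tmul_smul, zsmul_prufGen_self,
          TensorProduct.tmul_zero, map_zero]
      have hC : ∀ (c' : ℤ_[p]) (x' : D.X),
          D.toDual (PowerSeries.C c' • x') (θ (P i ⊗ₜ[ℤ] prufGen p N)) =
            (PadicInt.toZModPow N c').val • D.toDual x' (θ (P i ⊗ₜ[ℤ] prufGen p N)) :=
        fun c' x' ↦ D.toDual_C_smul c' x' _ N hsN
      have h1 := congrArg (fun w ↦ D.toDual w (θ (P i ⊗ₜ[ℤ] prufGen p N))) hcy
      beta_reduce at h1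
      rw [hxi0 y N (hPA i), map_sum, AddMonoidHom.finsetSum_apply] at h1
      simp_rw [hC, hx, hval] at h1
      rw [Finset.sum_eq_single i (fun k _ hk ↦ by rw [if_neg hk, mul_zero, zero_smul, smul_zero])
        (fun h ↦ (h (Finset.mem_univ i)).elim),
        if_pos rfl, smul_smul] at h1
      have h2 := addOrderOf_dvd_iff_nsmul_eq_zero.mpr h1
      rwa [hc₀', hc₀ N] at h2
    exact padicInt_eq_zero_of_forall_dvd (cc i) (mul_ne_zero (pow_ne_zero _ hp.ne_zero) hN₀) hdvd
  -- the images of the `x_k` are `ℤ_p`-independent in `Y = X^• / ξ_p X^•`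
  let Y := D.X ⧸ (Ideal.span {xi p} • ⊤ : Submodule (IwasawaAlgebra p) D.X)
  letI : Module ℤ_[p] Y := Module.compHom Y (algebraMap ℤ_[p] (IwasawaAlgebra p))
  haveI : IsScalarTower ℤ_[p] (IwasawaAlgebra p) Y := IsScalarTower.of_compHom ℤ_[p] _ _
  haveI : IsScalarTower ℤ_[p] (IwasawaAlgebra p ⧸ Ideal.span {xi p}) Y := inferInstance
  have hli : LinearIndependent ℤ_[p] (fun k ↦ (Submodule.Quotient.mk (x k) : Y)) := by
    rw [Fintype.linearIndependent_iff]
    intro cc hcc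
    have hsum : (Submodule.Quotient.mk (∑ k, (PowerSeries.C (cc k) : IwasawaAlgebra p) • x k) : Y)
        = 0 := by
      rw [← hcc, ← Submodule.mkQ_apply, map_sum]
      refine Finset.sum_congr rfl fun k _ ↦ ?_
      rw [map_smul, Submodule.mkQ_apply]
      change _ = (algebraMap ℤ_[p] (IwasawaAlgebra p) (cc k)) • (Submodule.Quotient.mk (x k) : Y)
      rw [PowerSeries.algebraMap_eq]
    rw [Submodule.Quotient.mk_eq_zero, Submodule.ideal_span_singleton_smul,
      Submodule.mem_smul_pointwise_iff_exists] at hsum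
    obtain ⟨y, -, hy⟩ := hsum
    exact hx0 cc y hy.symm
  have hrank : (((p - 1) * t : ℕ) : Cardinal) ≤ Module.rank ℤ_[p] Y :=
    le_trans (by exact_mod_cast hrk) (natCast_le_rank_iff.mpr ⟨_, hli⟩)
  -- rank conversion to `𝒪 = Λ/(ξ_p)` and lengths
  obtain ⟨hfree, hfin, hrkO⟩ := free_finite_finrank_quotient_xi (p := p)
  haveI := hfree; haveI := hfin
  haveI : IsDomain (IwasawaAlgebra p ⧸ Ideal.span {xi p}) :=
    (Ideal.Quotient.isDomain_iff_prime _).mpr (isPrime_span_xi p)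
  have hd : Module.rank ℤ_[p] (IwasawaAlgebra p ⧸ Ideal.span {xi p}) ≤ (p - 1 : ℕ) := by
    rw [← Module.finrank_eq_rank, hrkO]
  have hp1 : 1 ≤ p - 1 := by have := hp.two_le; omega
  obtain ⟨z, hz⟩ := exists_linearIndependent_of_rank_le hp1 hd
    (fun α hα ↦ exists_dvd_algebraMap_of_ne_zero α hα) t Y hrank
  exact natCast_le_lengthAt_of_linearIndependent 𝔭 h𝔭 D.X hz

/-- **Rank growth in the first layer ⇒ `ξ_p^t ∣ char_Λ X^•(E/K_∞)`** (torsion `X^•`; `…_of_colemanKer` +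
the tree's `xi_pow_dvd_of_mem_charIdeal_of_le_lengthAt`): the ♯/♭ form of Greenberg's "`θ_1^t` divides
`f_E(T)`". [cite: GreenbergLNM1716, §5 p. 132] [cite: Sprung2012, Def. 7.11 and Thm. 7.14 (p. 1503–1504)] -/
theorem xi_pow_dvd_of_mem_sharpFlat_charIdeal_of_rank_le_of_colemanKer
    (hdiv : W.zsmul_geomPoints_surjective) (hγ : κ.IsTopGenerator γ)
    (h𝒦 : ∀ z ∈ colemanKer κ (closureEmb (K := K) (v.adicCompletion K)) W ap g c col,
      ∀ (x : localPoints W (v.adicCompletion K))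
        (hx : x ∈ localLayerPointsOfEmb κ (closureEmb (K := K) (v.adicCompletion K)) W 1),
        z ⟨x, localLayerPointsOfEmb_le_localTowerPointsOfEmb κ _ W 1 hx⟩ = 0)
    (D : SharpFlatSelmerDualData W κ γ (closureEmb (K := K) (v.adicCompletion K)) ap g c col)
    [Module.Finite (IwasawaAlgebra p) D.X] (hD : Module.IsTorsion (IwasawaAlgebra p) D.X)
    {f : IwasawaAlgebra p} (hf : f ∈ D.charIdeal) {t : ℕ}
    (ht : W.mordellWeilRank + (p - 1) * t ≤ (W.baseChange (κ.layer 1)).mordellWeilRank) :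
    xi p ^ t ∣ f :=
  xi_pow_dvd_of_mem_charIdeal_of_le_lengthAt ⟨Ideal.span {xi p}, isPrime_span_xi p⟩ rfl D.X hD hf
    (natCast_le_lengthAt_of_rank_le_of_colemanKer W hdiv hγ h𝒦 D _ rfl ht)

end Main

/-! ## §3 Over `ℚ`, colour `♯`: the hypothesis discharged -/

section Rat

variable (W : WeierstrassCurve ℚ) [W.IsElliptic] (p : ℕ) [Fact p.Prime]

/-- **Rank growth in `ℚ_1` ⇒ `t ≤ ℓ_{(ξ_p)} X♯(E/ℚ_∞)`** in the setting of Sprung 2012 Thm. 2.2 /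
Def. 7.11 — `p ≠ 2`, `p ∣ a_p`, a `ℤ_p`-extension `κ` of `ℚ` with topological generator `γ`, the place
`v`, a local lift `g` of `γ`, a Honda system `(cneg, c)`, EVERY dual datum `D` of `Sel♯(E/ℚ_∞)` with `X♯`
finitely generated: if `rank E(ℚ) + (p − 1)·t ≤ rank E(ℚ_1)` (`ℚ_1 = κ.layer 1`; for the cyclotomic `κ`
and `p = 3` this is the cubic field `ℚ(ζ_9)⁺`), then `t ≤ ℓ_𝔭 X♯` at `𝔭 = (ξ_p)`. The local hypothesis of
§2 is the sibling theorem `colemanKer_sharp_apply_eq_zero_of_mem_localLayerPointsOfEmb_one`; `hdiv` is the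
tree theorem `zsmul_geomPoints_surjective_holds`. No reduction hypothesis, no control theorem, no `L`-value.
[cite: GreenbergLNM1716, §5 p. 132] [cite: Sprung2012, Def. 7.2 (p. 1500), Def. 7.11 (p. 1503), Thm. 2.2] -/
theorem rat_natCast_le_lengthAt_sharp_of_rank_le (hp2 : p ≠ 2) {ap : ℤ} (hap : (p : ℤ) ∣ ap)
    {κ : ZpExtension ℚ p} {γ : Field.absoluteGaloisGroup ℚ} (hγ : κ.IsTopGenerator γ)
    {v : HeightOneSpectrum (𝓞 ℚ)} {g : Field.absoluteGaloisGroup (v.adicCompletion ℚ)}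
    (hg : κ.IsTopGenerator (resGalOfEmb (closureEmb (K := ℚ) (v.adicCompletion ℚ)) g))
    {cneg : localPoints W (v.adicCompletion ℚ)} {c : ℕ → localPoints W (v.adicCompletion ℚ)}
    (hH : IsHondaSystem κ (closureEmb (K := ℚ) (v.adicCompletion ℚ)) W ap g cneg c)
    (D : SharpFlatSelmerDualData W κ γ (closureEmb (K := ℚ) (v.adicCompletion ℚ)) ap g c Chroma.sharp)
    [Module.Finite (IwasawaAlgebra p) D.X]
    (𝔭 : PrimeSpectrum (IwasawaAlgebra p)) (h𝔭 : 𝔭.asIdeal = Ideal.span {xi p}) {t : ℕ}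
    (ht : W.mordellWeilRank + (p - 1) * t ≤ (W.baseChange (κ.layer 1)).mordellWeilRank) :
    (t : ℕ∞) ≤ Module.lengthAt (IwasawaAlgebra p) D.X 𝔭 :=
  natCast_le_lengthAt_of_rank_le_of_colemanKer W W.zsmul_geomPoints_surjective_holds hγ
    (fun _ hz _ hx ↦ colemanKer_sharp_apply_eq_zero_of_mem_localLayerPointsOfEmb_one κ
      (closureEmb (K := ℚ) (v.adicCompletion ℚ)) W hp2 hap hg hH hz hx) D 𝔭 h𝔭 ht

end Rat

end Summit.BirchSwinnertonDyer.BirchSwinnertonDyer.Theorems.ChromaticCommonZeros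

end
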